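import Summits.ABC.IUTFork.Repair.RHToptKnapsackDualExistence
import Summits.ABC.IUTFork.Repair.RHAxisCK1Requirements
import Summits.ABC.IUTFork.Repair.RHSigmaSignedRemainder
import Summits.ABC.IUTFork.Repair.RHLabelWeightSchemes
import Summits.ABC.IUTFork.Repair.RHD1WithinPlaceNet
import Summits.ABC.IUTFork.Repair.RHHeightScaling
import HarnessLib

/-!
# R-H ROUND 4, row R4-7 «REQUIREMENT-SIDE DROP-ONE SHEETS», item (b) TYPING LANE (KEY «R4CON-TYPE»), part A: the T-LP's own rows —
# V1 (the BOX `0 ≤ ω ≤ 1`) and V2 (the NETTING row and its SCOPE) — what a theory WITHOUT the row must SUPPLY, as claim-tagged `Prop`s in OUR currency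

abc-iut cell, rung LADDER-ABC:A2.RESCUE.H; seat abc-iut-L5-t8 (GEN 10; KEY `wake/KEY-abc-iut-L5-t8-R4CON-TYPE.md` c222993d1b59221e, abc-iut-rh-lead g5 (OPENINGS-CENSUS pen)
2026-08-27T13:59Z under director-abc g6-D5/D7 and HUMAN D-0133 · D-0134 · D-0135; task = `ROUND4/R4-TASKS.md` row R4CON-TYPE). For each R4-7 drop-one sheet V<n>
(axis-C format; (b) = «what a theory WITHOUT this constraint must supply instead, as claim-tagged `def … : Prop` signatures for the typing lane») this lane types item
(b) over the typed cell currency, citing landed decls BY NAME (nothing re-declared): the T-LP of record `RHToptKnapsackDual` / `…DualExistence` (p488805: (P)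
`max Σ ω t` s.t. `0 ≤ ω ≤ 1`, `Σ ω ŝ ≥ 0`; 0 definitions there — §0 below NAMES its rows), the weighted door p480491 `RHSigmaSignedRemainder` (`weightedDeficit`,
`weightedTrivialMass`, `StatementUpTo`), and abc-iut-reqb-typ-1's R79 lane conventions (`RHAxisCK1Requirements`, p534392). PART A (this file): §0 the rows as named
predicates · §V1 sheet V1 (rh3-gen-1) · §V2 sheet V2 (rh3-gen-2). PART B (`RHRound4ConstraintRequirementsB.lean`): V3 (honest cone) + V4 (label symmetry); PART C:
V5 (place aggregation) + V6 (container/rounding) — three files for the 400-line rule (D-0064), none importing another.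
HONEST FRAMING / GUARDS: every `def … : Prop` here is a HYPOTHESIS-SHAPED REQUIREMENT in OUR typed cell currency — what a hypothetical theory dropping the row would
have to certify — not a reading of [IUTchI–IV], not a claim that such objects exist, NEVER a Literature fact (FROZEN FACT-LIST f75a60bac22efdb6; 0 new Literature
Props; no `instance` / `notation` / `macro`); the few theorems are calibrations / bookkeeping faces the sheets asked for (V1 B2/B4), not evidence for any row;
located ≠ adjudicated; typed ≠ proved; computed ≠ proved; no side on [IUTchIII] Cor 3.12 / Rmk 3.9.x / [IUTchIV] Thm 1.10 or on any author (D-0045); nothing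
here asserts that abc is proved or refuted. [claim: Mochizuki2012, status: disputed] for every IUT locution.
[cite: Mochizuki2012, IUTchIII Cor. 3.12 p. 173–174, Prop. 3.9 (i) p. 116, Rmk. 3.9.3 p. 119–120; IUTchIV Thm. 1.10 Step (iv)–(viii) p. 26–30]
-/

noncomputable section
open Finset
namespace Summit.ABC.IUTFork.Repair.RH.Round4ConstraintRequirements
open Summit.ABC.IUTFork.Repair.RH.ToptKnapsack Summit.ABC.IUTFork.Repair.RH.SigmaLicence Summit.ABC.IUTFork.Repair.RH.SigmaMass
  Summit.ABC.IUTFork.Repair.RH.ReqsideWeightLaws Literature.IUT.LogThetaLattice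

/-! ## §0. The T-LP of record and its validity constraints as NAMED ROWS (the objects the six sheets drop one at a time) -/

section Rows

variable {ι 𝕜 : Type*} [Field 𝕜] [LinearOrder 𝕜] [IsStrictOrderedRing 𝕜]

/-- **Row V1 — the BOX** `0 ≤ ω c ≤ 1` on every cell of the table `s`: each cell enters the averaging scheme at most once and with no negative weight
(the hypotheses `h0`/`h1` of `ToptKnapsack.kept_le_dual`, p488805). A row of OUR LP, not an IUT object. [claim: Mochizuki2012, status: disputed] -/
@[claim "Mochizuki2012" "disputed"]
def BoxRow (s : Finset ι) (ω : ι → 𝕜) : Prop :=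
  ∀ c ∈ s, 0 ≤ ω c ∧ ω c ≤ 1

/-- **Row V2 — the NETTING row, ACROSS-places scope** `Σ_{c ∈ s} ω c·ŝ c ≥ 0` over the whole cell table (one global constraint — what the weighted door
p480491 literally allows; the hypothesis `hnet` of `kept_le_dual`). [claim: Mochizuki2012, status: disputed] -/
@[claim "Mochizuki2012" "disputed"]
def NettingRow (s : Finset ι) (ŝ ω : ι → 𝕜) : Prop :=
  0 ≤ ∑ c ∈ s, ω c * ŝ c

/-- **Row V2, WITHIN-place scope**: one netting constraint per place `w` of a place set `W`, over that place's cells `cells w ⊆ s` (D0121-SPEC §1.1 tier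
(2a); AXIS-D1's «closes within place»). [claim: Mochizuki2012, status: disputed] -/
@[claim "Mochizuki2012" "disputed"]
def NettingRowWithin {W : Type*} (places : Finset W) (cells : W → Finset ι) (ŝ ω : ι → 𝕜) : Prop :=
  ∀ w ∈ places, 0 ≤ ∑ c ∈ cells w, ω c * ŝ c

/-- **Row V3 — LICENSING / the HONEST CONE** as a constraint on the TABLE `(t, ŝ)`: masses `t ≥ 0`; a licensed cell carries its certified exact slack
`ŝ c = slack c ≥ 0`; an unlicensed cell is worth `ŝ c = −t c + κ c` with a certified partial credit `0 ≤ κ c ≤ t c` — never more than its own trivial mass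
(D0121-SPEC §1.0 «d(c) ≤ t(c) always»: `SigmaLicence.cellDeficit_le_cellTrivialCost`; `Cor312Vol.logvol_possibleImage_eq` = no possible image does better).
[claim: Mochizuki2012, status: disputed] -/
@[claim "Mochizuki2012" "disputed"]
def HonestConeRow (s : Finset ι) (licensed : ι → Prop) (t slack κ ŝ : ι → 𝕜) : Prop :=
  ∀ c ∈ s, 0 ≤ t c ∧ (licensed c → 0 ≤ slack c ∧ ŝ c = slack c) ∧ (¬ licensed c → 0 ≤ κ c ∧ κ c ≤ t c ∧ ŝ c = -t c + κ c)

/-- Under the honest cone every cell's debt is at most its mass: `−t c ≤ ŝ c` (so a deficit cell's value/cost ratio is `≤ 1`, cf. `ToptKnapsack.kept_le_total`).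
[folklore] -/
theorem HonestConeRow.neg_mass_le {s : Finset ι} {licensed : ι → Prop} {t slack κ ŝ : ι → 𝕜}
    (h : HonestConeRow s licensed t slack κ ŝ) {c : ι} (hc : c ∈ s) : -t c ≤ ŝ c := by
  obtain ⟨ht, hl, hu⟩ := h c hc
  by_cases hlc : licensed c
  · obtain ⟨hs, he⟩ := hl hlc; rw [he]; linarith
  · obtain ⟨hk, -, he⟩ := hu hlc; rw [he]; linarith

end Rows

/-! ## §V1. Sheet V1 — the BOX `0 ≤ ω(c) ≤ 1` (census O-10; rh3-gen-1 g8, `ROUND4/R4-7-V1-abc-iut-rh3-gen-1.md` 3737f604ac31b705; referee rh-ref-1; bed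
rh3-tst-1 `R4-7-BED-V1-rh3-tst-1.tsv`). Sheet §0: V1⁺ `ω c ≤ 1` («a cell counted at most once») is a HYPOTHESIS of the weighted door p480491; V1⁻ `0 ≤ ω c`
(«no cell subtracted») is not — it enters only the LP model. Item (b): B1 the DEFICIT FLOOR (the single requirement object) · B2 the door beyond the box (expected
provable — PROVED below) · B3 the KEY's multiplicity object typed where it lives (price column → V3/V6) · B4 the LP face «relaxed box idle at tier LIC» (typer
ask T-V1 — PROVED below) · B5 not this row (label weights → V4, place weights → V5, signed credit → V3). -/

section V1Kernel

open Summit.ABC.IUTFork.Thm311 Summit.ABC.IUTFork.Cor312 Summit.ABC.IUTFork.Cor312.Setting Summit.ABC.IUTFork.Cor312Vol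

variable {T : ThetaIndex} {S : Situation T} (P : Cor312.Setting S)

/-- **B1 — the DEFICIT FLOOR, the single requirement object of V1** (sheet (b) B1 «`def V1_deficitFloor (P) (c : Fin T.lstar × T.VQ) : Prop := cellTrivialCost P c
≤ cellDeficit P c.1 c.2` … the holomorphic hull at (j, v) adds NO log-volume to the chosen possible-image region AND the cell is a genuine deficit cell — a
certified TWO-SIDED volume statement (“this label is exactly worst-case”). With the landed one-sided cone `cellDeficit_le_cellTrivialCost` it forces `cellDeficit
= cellTrivialCost` on c … Both halves of the box are free exactly on B1-cells, and nowhere else. Print supplies no B1-cell (A-null: upper bounds only); KEY's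
objects: “a cell counted with multiplicity” needs B1 on that cell (door side), “a cell subtracted” needs B1 on that cell (model side)»). HYPOTHESIS in OUR typed
currency (p477034 `cellTrivialCost`, p479556 `cellDeficit`); claim-tagged requirement, not a Literature fact, licenses nothing by itself. [claim: Mochizuki2012, status: disputed] -/
@[claim "Mochizuki2012" "disputed"]
def V1_deficitFloor (c : Fin T.lstar × T.VQ) : Prop :=
  cellTrivialCost P c ≤ cellDeficit P c.1 c.2

variable {P}

/-- On a B1-cell the deficit IS the trivial cost (floor + the landed honest cone `cellDeficit_le_cellTrivialCost`, p480491). [claim: Mochizuki2012, status: disputed] -/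
theorem cellDeficit_eq_cellTrivialCost_of_deficitFloor (H : BridgeHyps P) {c : Fin T.lstar × T.VQ} (h : V1_deficitFloor P c) :
    cellDeficit P c.1 c.2 = cellTrivialCost P c :=
  le_antisymm (cellDeficit_le_cellTrivialCost H c) h

variable (P)

/-- **B2 — the DOOR BEYOND THE BOX** (sheet (b) B2 «`def V1_doorBeyondBox (P) : Prop := ∀ ω : Fin T.lstar × T.VQ → ℝ, (∀ c, ω c ≤ 1 ∨ V1_deficitFloor P c) →
weightedDeficit P ω ≤ 0 → StatementUpTo P (weightedTrivialMass P ω)` (claim). Sketch (for a prover, ≤ 25 lines on top of p480491) … So “ω > 1 somewhere” is NOT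
inconsistent with our door; it is consistent AND idle (B4)»): p480491's weighted door with V1⁺ required only OFF the B1-cells. PROVED under the bridge hypotheses
(`V1_doorBeyondBox_holds`) — hence, as the sheet says, not a requirement but the reason B1 is the only one. [claim: Mochizuki2012, status: disputed] -/
@[claim "Mochizuki2012" "disputed"]
def V1_doorBeyondBox : Prop :=
  ∀ ω : Fin T.lstar × T.VQ → ℝ, (∀ c, ω c ≤ 1 ∨ V1_deficitFloor P c) →
    weightedDeficit P ω ≤ 0 → StatementUpTo P (weightedTrivialMass P ω)

variable {P}

/-- The co-weighted charge is dominated by the co-weighted trivial mass when, at every cell, `ω ≤ 1` OR the deficit floor holds (p480491's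
`weightedDeficit_compl_le_weightedTrivialMass` with the box hypothesis relaxed on B1-cells, where `(1−ω)·d = (1−ω)·t`). [claim: Mochizuki2012, status: disputed] -/
theorem weightedDeficit_compl_le_weightedTrivialMass_of_box_or_floor (H : BridgeHyps P) {ω : Fin T.lstar × T.VQ → ℝ}
    (hω : ∀ c, ω c ≤ 1 ∨ V1_deficitFloor P c) : weightedDeficit P (fun c => 1 - ω c) ≤ weightedTrivialMass P ω := by
  unfold weightedDeficit weightedTrivialMass processionNormalized
  refine div_le_div_of_nonneg_right (Finset.sum_le_sum fun i _ => ?_) (Nat.cast_nonneg _)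
  refine finsum_le_finsum' (weightedDeficit_support_finite H (fun c => 1 - ω c) i) (weightedTrivialMass_support_finite H ω i) fun vQ => ?_
  rcases hω (i, vQ) with h1 | hfl
  · exact mul_le_mul_of_nonneg_left (cellDeficit_le_cellTrivialCost H (i, vQ)) (by linarith)
  · rw [cellDeficit_eq_cellTrivialCost_of_deficitFloor H hfl]

/-- **`V1_doorBeyondBox P` HOLDS** under the bridge hypotheses (the sheet's B2 sketch, on top of p480491: `D = PN Σ ω·d + PN Σ (1−ω)·d ≤ 0 + PN Σ (1−ω)·t`).
«follows AS TYPED»; nothing asserted about the hypotheses at any datum. [claim: Mochizuki2012, status: disputed] -/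
theorem V1_doorBeyondBox_holds (H : BridgeHyps P) : V1_doorBeyondBox P := fun ω hω h =>
  (statementUpTo_iff_signedRemainder_le H _).mpr (by
    rw [signedRemainder_eq_weightedDeficit_add H ω]
    linarith [weightedDeficit_compl_le_weightedTrivialMass_of_box_or_floor H hω])

/-- **B3 — the KEY's MULTIPLICITY object, typed where it lives** (sheet (b) B3 «(“several arithmetic holomorphic structures contributing the same label”) … The only
contentful version keeps the demand `t c` once and claims an m-fold SAVING: `def V1_independentCopies (m : ℕ) (price price' : (Fin T.lstar × T.VQ) → ℝ) : Prop :=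
∀ c, (m : ℝ) * price c ≤ price' c` (claim) — “the union of the possible-image families of m structures at (j, w) has container/hull credit ≥ m × the
single-structure credit”. That is a statement about the PRICE / LICENCE column `ŝ` (rows V3 (O-12) and V6), not about the box … never `m·OPT`. Handed to
rh3-gen-3 (V3) / rh3-gen-5 (V6) BY NAME»): `price` the single-structure credit per cell, `price'` the m-structure credit. HYPOTHESIS in OUR currency.
[claim: Mochizuki2012, status: disputed] -/
@[claim "Mochizuki2012" "disputed"]
def V1_independentCopies (m : ℕ) (price price' : Fin T.lstar × T.VQ → ℝ) : Prop :=
  ∀ c, (m : ℝ) * price c ≤ price' c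

end V1Kernel

section V1Table

variable {ι 𝕜 : Type*} [Field 𝕜] [LinearOrder 𝕜] [IsStrictOrderedRing 𝕜]

/-- **B4 — THE LP FACE «the relaxed box is IDLE at tier LIC»** (sheet (b) B4, typer ask T-V1: «`theorem kept_le_surplusValue_of_le_one_on_licensed (h1 : ∀ c ∈ s, 0 ≤ ŝ c
→ ω c ≤ 1) (hnet : 0 ≤ Σ_{c∈s} ω c * ŝ c) (hunit : ∀ c ∈ s, ŝ c < 0 → ŝ c = −t c) (ht : ∀ c ∈ s, 0 ≤ t c) : Σ_{c∈s} ω c * t c ≤ mass σ + C_σ` — NO lower bound on ω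
anywhere, NO upper bound on unlicensed cells. Hand proof (3 lines): `Σ ω t = Σ_lic ω t − Σ_unl ω ŝ ≤ Σ_lic ω t + Σ_lic ω ŝ = Σ_lic ω (t + ŝ) ≤ Σ_lic (t + ŝ)` … i.e.
weak duality at the certificate `y = 1` (`reducedCost_one_nonneg`, `dual_at_one_eq`)»), in `RHToptKnapsackDegenerate`'s currency (p490154: the surplus value
`Σ_{ŝ ≥ 0} (t + ŝ) = mass(σ) + C_σ`, `surplusValue_eq_mass_add_credit`): with V1⁻ DROPPED everywhere and V1⁺ kept on licensed cells only, every netting-feasible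
scheme still keeps `≤ mass(σ) + C_σ`. [folklore] -/
theorem kept_le_surplusValue_of_le_one_on_licensed {s : Finset ι} {t ŝ ω : ι → 𝕜} (ht : ∀ c ∈ s, 0 ≤ t c)
    (hunit : ∀ c ∈ s, ŝ c < 0 → ŝ c = -t c) (h1 : ∀ c ∈ s, 0 ≤ ŝ c → ω c ≤ 1) (hnet : 0 ≤ ∑ c ∈ s, ω c * ŝ c) :
    ∑ c ∈ s, ω c * t c ≤ ∑ c ∈ s.filter (fun c => 0 ≤ ŝ c), (t c + ŝ c) := by
  rw [← Finset.sum_filter_add_sum_filter_not s (fun c => 0 ≤ ŝ c) (fun c => ω c * t c)]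
  rw [← Finset.sum_filter_add_sum_filter_not s (fun c => 0 ≤ ŝ c) (fun c => ω c * ŝ c)] at hnet
  -- on the unlicensed cells `t = −ŝ`
  have hU : ∑ c ∈ s.filter (fun c => ¬ 0 ≤ ŝ c), ω c * t c = -∑ c ∈ s.filter (fun c => ¬ 0 ≤ ŝ c), ω c * ŝ c := by
    rw [← Finset.sum_neg_distrib]
    refine Finset.sum_congr rfl fun c hc => ?_
    obtain ⟨hcs, hsc⟩ := Finset.mem_filter.mp hc
    rw [hunit c hcs (not_le.mp hsc)]; ring
  -- on the licensed cells `ω·(t + ŝ) ≤ t + ŝ`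
  have hL : ∑ c ∈ s.filter (fun c => 0 ≤ ŝ c), (ω c * t c + ω c * ŝ c) ≤ ∑ c ∈ s.filter (fun c => 0 ≤ ŝ c), (t c + ŝ c) :=
    Finset.sum_le_sum fun c hc => by
      obtain ⟨hcs, hsc⟩ := Finset.mem_filter.mp hc
      have hts : 0 ≤ t c + ŝ c := add_nonneg (ht c hcs) hsc
      nlinarith [h1 c hcs hsc]
  rw [Finset.sum_add_distrib] at hL
  linarith

end V1Table

/-! ## §V2. Sheet V2 — the NETTING ROW `Σ_c ω_c·ŝ_c ≥ 0` and its SCOPE (census O-11; rh3-gen-2 g9, `ROUND4/R4-7-V2-abc-iut-rh3-gen-2.md` v1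
3b74502bb0ffc0e3; referee rh-ref-2; bed rh3-tst-2 `R4-7-BED-V2-rh3-tst-2.tsv`). Item (b) objects B0 · B0′ · B-print · B1 · B2 · B3 · B4 · B5, typed over
(i) the LP table of record (scopes = the netting row over a PARTITION of the cells, the sheet's device `NET(𝒫)`), (ii) the kernel setting currency
(`credit`, `offRemainder ∅`, `Statement` of a FAMILY of settings — the widenings B1/B2 and the transfer door they would need), (iii) the height-scaling
vocabulary p532994 (B5, the mediant law). Sheet label (e): «V2 = CONSISTENT (print's own scope) · widenings B1/B2 CONSISTENT-UNMOTIVATED and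
exponent-inert (−1 EXACTLY, mediant law) · B3 INCONSISTENT (kernel, → V3) · status KILLED-BY-DATA for every scope as a window supplier; residual
object = `XferLaw` (O-07, unlocated); nothing LIVE on this row» — the sheet's words, located ≠ adjudicated. -/

section V2Table

variable {ι 𝕜 : Type*} [Field 𝕜] [LinearOrder 𝕜] [IsStrictOrderedRing 𝕜]

/-- **V2 READ AS A SCOPE FAMILY** (sheet §0 «replace the single row by one row per group `G` of a partition `𝒫` of the cells, `NET(𝒫) := ∀ G ∈ 𝒫,
Σ_{c∈G} ω_c·ŝ c ≥ 0` … finest to coarsest: cells (scope NONE) ≼ places (WITHIN) ≼ datum (ACROSS = print's single PN-average = the LP's one row);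
coarser `𝒫` ⇒ weaker constraint»): the netting row imposed on every group of a family `𝒫` of cell sets. `𝒫 = {s}`: `NettingRow` (B-print);
`𝒫 =` the places: `NettingRowWithin` (B0′); `𝒫 =` singletons: scope NONE (B0, `scopeNone_iff_noNetting`). A row family of OUR LP, not an IUT object.
[claim: Mochizuki2012, status: disputed] -/
@[claim "Mochizuki2012" "disputed"]
def NettingRowScoped (groups : Finset (Finset ι)) (ŝ ω : ι → 𝕜) : Prop :=
  ∀ G ∈ groups, 0 ≤ ∑ c ∈ G, ω c * ŝ c

/-- **B0 `NoNetting`** (sheet (b) B0 «`NoNetting (P : Datum) : Prop := ∀ c, c ∉ σ(P) → ω c = 0` — scope NONE (“row dropped”): only individually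
certified cells may be kept. STATUS: OUR typing, STRICTER than print (A5); kernel floor `le_iff_forall_licenceConsistent`; supplies NOTHING new — it is
the constraint whose RELAXATION print already uses. Its bed word is μ₄ / μ_L1 (c-S1)»), at the LP table: the scheme vanishes off the licensed set `σ`.
(Kernel reading, by name: the cellwise licence `SigmaLicence.LicenceOn P σ` with `ω = 1_σ`, door `statementUpTo_offTrivialMass_of_licenceOn`, p477034.)
Requirement in OUR currency, licenses nothing by itself. [claim: Mochizuki2012, status: disputed] -/
@[claim "Mochizuki2012" "disputed"]
def V2_B0_noNetting (s : Finset ι) (σ : Finset ι) (ω : ι → 𝕜) : Prop :=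
  ∀ c ∈ s, c ∉ σ → ω c = 0

/-- Scope NONE is the SINGLETON partition: for a box-feasible scheme on a table whose cells off `σ` are DEFICIT cells (`ŝ < 0`, the honest cone's
unlicensed cells with `κ < t`) and whose cells on `σ` carry `ŝ ≥ 0`, the per-cell netting rows `ω c·ŝ c ≥ 0` hold iff the scheme vanishes off `σ`
(sheet §0 «cells (scope NONE = netting row DROPPED … = licence-only / cell-by-cell certification = OUR round-1/2 typing)»). [folklore] -/
theorem scopeNone_iff_noNetting [DecidableEq ι] {s σ : Finset ι} {ŝ ω : ι → 𝕜} (hσ : ∀ c ∈ s, c ∈ σ → 0 ≤ ŝ c) (hoff : ∀ c ∈ s, c ∉ σ → ŝ c < 0)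
    (h0 : ∀ c ∈ s, 0 ≤ ω c) :
    NettingRowScoped (s.image fun c => ({c} : Finset ι)) ŝ ω ↔ V2_B0_noNetting s σ ω := by
  unfold NettingRowScoped V2_B0_noNetting
  simp only [Finset.mem_image, forall_exists_index, and_imp, forall_apply_eq_imp_iff₂, Finset.sum_singleton]
  constructor
  · intro h c hc hcσ
    have h1 := h c hc
    have h2 := hoff c hc hcσ
    by_contra hne
    have hpos : 0 < ω c := lt_of_le_of_ne (h0 c hc) (Ne.symm hne)
    nlinarith
  · intro h c hc
    by_cases hcσ : c ∈ σ
    · exact mul_nonneg (h0 c hc) (hσ c hc hcσ)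
    · rw [h c hc hcσ, zero_mul]

/-- **B0′ `NetWithinPlace`** (sheet (b) B0′ «`NetWithinPlace (P) : Prop := ∀ w, Σ_{j} u_{w,j}·ŝ(w,j) ≥ 0` — scope PLACES. STATUS: intermediate typing (AXIS-D2
row 3 class `ObjectClass.withinPlaceFinancing`, kernel p532255 `RHWithinPlaceFinancingHeightLaw`, cap p532824 `sum_slack_le_capPi`); weaker than B0,
stronger than print; bed word L0a / L1a (c-S2)»): the netting row per place, at print's FIXED weights `ω ≡ 1` (the place weights `u_{w,j}` live inside
the table's `ŝ`, MIN-SLICE (i)); bed face per place `0 ≤ D1WithinPlaceNet.placeNet …` («closes within», p535526 lineage). Requirement in OUR currency.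
[claim: Mochizuki2012, status: disputed] -/
@[claim "Mochizuki2012" "disputed"]
def V2_B0'_netWithinPlace {W : Type*} (places : Finset W) (cells : W → Finset ι) (ŝ : ι → 𝕜) : Prop :=
  NettingRowWithin places cells ŝ fun _ => 1

/-- **B-print `NetAcrossPlaces`** (sheet (b) «`NetAcrossPlaces (P) : Prop := Σ_{w,j} u_{w,j}·ŝ(w,j) ≥ 0` — scope DATUM = the LP row = print (A1–A5) =
`statementUpTo_iff_debt_sub_credit_le`; class `ObjectClass.acrossPlaceNetting` (AXIS-D2 row 5; kernel p531669 `RHNettingHeightExponent`, p533038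
`…Tier`); bed word L0b / L1b (c-S3). Everything below WIDENS this»): the ONE netting row over the whole table at `ω ≡ 1`. Kernel reading BY NAME:
`SigmaLicence.statement_iff_offRemainder_empty_le_credit` (Statement ⟺ debt `R_∅ ≤` credit `C`, p479556). [claim: Mochizuki2012, status: disputed] -/
@[claim "Mochizuki2012" "disputed"]
def V2_Bprint_netAcrossPlaces (s : Finset ι) (ŝ : ι → 𝕜) : Prop :=
  NettingRow s ŝ fun _ => 1

omit [IsStrictOrderedRing 𝕜] in
/-- `V2_Bprint_netAcrossPlaces s ŝ ↔ 0 ≤ Σ_{c∈s} ŝ c` (print's fixed weights: the row is the sign of the table's total slack). [folklore] -/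
theorem V2_Bprint_iff_sum_nonneg (s : Finset ι) (ŝ : ι → 𝕜) : V2_Bprint_netAcrossPlaces s ŝ ↔ 0 ≤ ∑ c ∈ s, ŝ c := by
  unfold V2_Bprint_netAcrossPlaces NettingRow
  simp only [one_mul]

/-- **B3 `SignedCreditBeyondSlack`** (sheet (b) B3 «`∃ c ∈ σ(P), credit c > price c − demand c ∨ ∃ c ∉ σ(P), d(c) < t(c) − κ(c) is credited` — “signed
credits beyond the certified slack”. STATUS: INCONSISTENT (kernel) with the honest cone as typed: the credit of a licensed cell IS the slack, EQUALITY both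
signs at the sharp setting (p481438 `cellSlack_settingPrVolSharp_eq`; `RHSigmaLicenceSigned.cellDeficit_eq_neg_credit_of_mem_licenceCells`), and an
unlicensed cell's deficit is bounded below by the honest cone (`cellDeficit_le_qLocal_sub_image`, `Cor312Vol….logvol_possibleImage_eq`) … A theory
supplying B3 denies V3's row, not V2's: handed to O-12»), at the LP table: some cell's model slack EXCEEDS what row V3 certifies — a licensed cell
credited beyond its exact slack, or an unlicensed cell beyond `−t + κ`. By construction `V3`-tables exclude it (`not_B3_of_honestConeRow`). Requirement in
OUR currency (what such a theory would have to certify), licenses nothing. [claim: Mochizuki2012, status: disputed] -/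
@[claim "Mochizuki2012" "disputed"]
def V2_B3_signedCreditBeyondSlack (s : Finset ι) (licensed : ι → Prop) (t slack κ ŝ : ι → 𝕜) : Prop :=
  ∃ c ∈ s, (licensed c ∧ slack c < ŝ c) ∨ (¬ licensed c ∧ -t c + κ c < ŝ c)

omit [IsStrictOrderedRing 𝕜] in
/-- A table obeying row V3 (`HonestConeRow`) has no signed credit beyond slack: B3 DENIES V3, as the sheet says. [folklore] -/
theorem not_B3_of_honestConeRow {s : Finset ι} {licensed : ι → Prop} {t slack κ ŝ : ι → 𝕜}
    (h : HonestConeRow s licensed t slack κ ŝ) : ¬ V2_B3_signedCreditBeyondSlack s licensed t slack κ ŝ := by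
  rintro ⟨c, hc, hB⟩
  obtain ⟨-, hl, hu⟩ := h c hc
  rcases hB with ⟨hlc, hlt⟩ | ⟨hlc, hlt⟩
  · rw [(hl hlc).2] at hlt; exact lt_irrefl _ hlt
  · rw [(hu hlc).2.2] at hlt; exact lt_irrefl _ hlt

/-- **B4 `FreeWeights`** (sheet (b) B4 «`FreeWeights (P) : Prop := ∃ ω ≠ uniform, feasible ∧ kept(ω) > kept(uniform)` — netting with NON-uniform label/place
weights. STATUS: INCONSISTENT-as-a-print-reading (A3 “no choice but to assign the same weights”); it is V1's territory (box / as-posed tiers, O-10); its only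
bed effect is on the as-posed tier (D0121 §1.1⁗ “WEIGHTS NEVER MATTER off the as-posed tier”; c-S7)»), at the LP table: some box- and netting-feasible
scheme keeps MORE than the best CONSTANT scheme (`ω ≡ 1` keeps `Σ t` if the table nets, else the only feasible constant is `ω ≡ 0`). Requirement in OUR
currency. [claim: Mochizuki2012, status: disputed] -/
@[claim "Mochizuki2012" "disputed"]
def V2_B4_freeWeights (s : Finset ι) (t ŝ : ι → 𝕜) : Prop :=
  ∃ ω : ι → 𝕜, BoxRow s ω ∧ NettingRow s ŝ ω ∧
    (if 0 ≤ ∑ c ∈ s, ŝ c then ∑ c ∈ s, t c else 0) < ∑ c ∈ s, ω c * t c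

end V2Table

section V2Family

open Summit.ABC.IUTFork.Thm311 Summit.ABC.IUTFork.Cor312 Summit.ABC.IUTFork.Cor312.Setting Summit.ABC.IUTFork.Cor312Vol

variable {K : Type*} {T : K → ThetaIndex} {S : (k : K) → Situation (T k)}

/-- **B1/B2 — NETTING ACROSS A FAMILY of settings** (sheet (b) B1 «`NetAcrossPrimes (C : CurveDatum) (Λ : Finset ℕ) (ν : ℕ → ℝ≥0) : Prop := Σ_{l∈Λ}
ν_l·(credit(C,l) − debt(C,l)) ≥ 0` — scope CURVE» and B2 «`NetAcrossCurves (𝔅 : Finset CurveDatum) (ν) : Prop := Σ_{C∈𝔅} ν_C·(credit C − debt C) ≥ 0` —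
scope BED / FAMILY»; «STATUS: as a STATEMENT … a positive combination of the per-l netted Statements (“implied by ∀ l ∈ Λ, implies ∃ l ∈ Λ” —
R4-6-MULTIL-rh2-q2-eq.md bec98f5d91fbfa56 §1 (R1)/(R2)): no new content, CONSISTENT with I–IV trivially and UNMOTIVATED (no locus, A6/A7)»): for a finite
family `Λ` of Cor 3.12 settings `P k` (B1: `K = ℕ`, `k = l` the prime, the settings those of ONE curve at the primes `l ∈ Λ`; B2: `K =` curves of a bed —
the indexing is DATA, the Prop is the same) and weights `ν ≥ 0`, the ν-combination of «credit − debt» is `≥ 0`, where debt `= offRemainder (P k) ∅` and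
credit `= credit (P k)` (p479556 / p480491: `Statement ⟺ R_∅ ≤ C`). Both status sentences are `netAcrossFamily_of_forall_statement` /
`exists_statement_of_netAcrossFamily` below. Requirement in OUR currency, licenses nothing by itself. [claim: Mochizuki2012, status: disputed] -/
@[claim "Mochizuki2012" "disputed"]
def V2_netAcrossFamily (Λ : Finset K) (P : (k : K) → Cor312.Setting (S k)) (ν : K → ℝ) : Prop :=
  0 ≤ ∑ k ∈ Λ, ν k * (credit (P k) - offRemainder (P k) ∅)

/-- «implied by ∀ k ∈ Λ»: if every member's printed Statement holds, the family nets for every `ν ≥ 0` (each term is `ν_k·(C_k − R_k) ≥ 0` by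
`statement_iff_offRemainder_empty_le_credit`). [claim: Mochizuki2012, status: disputed] -/
theorem netAcrossFamily_of_forall_statement {Λ : Finset K} {P : (k : K) → Cor312.Setting (S k)} {ν : K → ℝ}
    (H : ∀ k ∈ Λ, BridgeHyps (P k)) (hν : ∀ k ∈ Λ, 0 ≤ ν k) (h : ∀ k ∈ Λ, (P k).Statement) : V2_netAcrossFamily Λ P ν := by
  refine Finset.sum_nonneg fun k hk => mul_nonneg (hν k hk) ?_
  have := (statement_iff_offRemainder_empty_le_credit (H k hk)).mp (h k hk)
  unfold credit
  linarith

/-- «implies ∃ k ∈ Λ»: if the family nets with weights `ν ≥ 0` not all zero, SOME member with `ν_k > 0` satisfies its printed Statement (a positive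
combination of reals `≥ 0` has a non-negative member) — the family statement's content is `≤` its best member's. [claim: Mochizuki2012, status: disputed] -/
theorem exists_statement_of_netAcrossFamily {Λ : Finset K} {P : (k : K) → Cor312.Setting (S k)} {ν : K → ℝ}
    (H : ∀ k ∈ Λ, BridgeHyps (P k)) (hν : ∀ k ∈ Λ, 0 ≤ ν k) (hpos : ∃ k ∈ Λ, 0 < ν k) (h : V2_netAcrossFamily Λ P ν) :
    ∃ k ∈ Λ, 0 < ν k ∧ (P k).Statement := by
  classical
  by_contra hno
  push Not at hno
  have hlt : ∑ k ∈ Λ, ν k * (credit (P k) - offRemainder (P k) ∅) < 0 := by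
    obtain ⟨k₀, hk₀, hν₀⟩ := hpos
    have hneg : ∀ k ∈ Λ, ν k * (credit (P k) - offRemainder (P k) ∅) ≤ 0 := fun k hk => by
      rcases (hν k hk).eq_or_lt with h0 | hp
      · rw [← h0, zero_mul]
      · have hns := hno k hk hp
        rw [statement_iff_offRemainder_empty_le_credit (H k hk), not_le] at hns
        unfold credit
        nlinarith
    have hk₀neg : ν k₀ * (credit (P k₀) - offRemainder (P k₀) ∅) < 0 := by
      have hns := hno k₀ hk₀ hν₀
      rw [statement_iff_offRemainder_empty_le_credit (H k₀ hk₀), not_le] at hns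
      unfold credit
      nlinarith
    calc ∑ k ∈ Λ, ν k * (credit (P k) - offRemainder (P k) ∅)
        = ν k₀ * (credit (P k₀) - offRemainder (P k₀) ∅) + ∑ k ∈ Λ.erase k₀, ν k * (credit (P k) - offRemainder (P k) ∅) :=
          (Finset.add_sum_erase Λ _ hk₀).symm
      _ < 0 + 0 := add_lt_add_of_lt_of_le hk₀neg (Finset.sum_nonpos fun k hk => hneg k (Finset.mem_of_mem_erase hk))
      _ = 0 := add_zero 0
  exact absurd h (not_le.mpr hlt)

/-- **THE V2 REQUIREMENT — the TRANSFER DOOR a widening must supply** (sheet (b) B1 «As an OBJECT that could supply mass to ONE target prime l₀ it needs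
the cross-l TRANSFER LAW `XferLaw C Λ l₀ : Prop` := “the covered (price) mass of the unlicensed cells of the packets at l ∈ Λ ∖ {l₀} may be credited against
the deficits of the packet at l₀ …” (MULTIL §2(d), residual R-07×; census row O-07's object, not re-typed here)»; (e) «The only reading of B1 that escapes
the class law is the OBJECT `XferLaw` with a pool GROWING with height»; census text «residual (Lean statement): `XferLaw C Λ l₀` … the only object that turns
a wider netting scope into mass for ONE requirement; for V2 proper: none»). Typed here as the CONCLUSION such an object must license, in OUR currency and
without positing its mechanism (the mechanism `XferLaw`/`ClassMultiL` is rh2-T-1's row O-07): «family-netted at weights `ν` ⟹ member `k₀`'s Corollary up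
to `ε`». At `Λ = {k₀}`, `ν k₀ > 0`, `ε = 0` this IS print's own door (`V2_requirement_singleton_iff`); for `|Λ| ≥ 2` nothing in the tree proves it
(`exists_statement_of_netAcrossFamily` only yields SOME member). HYPOTHESIS-SHAPED requirement; claim-tagged, not a Literature fact, licenses nothing by
itself; nothing here asserts such a transfer exists. [claim: Mochizuki2012, status: disputed] -/
@[claim "Mochizuki2012" "disputed"]
def V2_requirement (Λ : Finset K) (P : (k : K) → Cor312.Setting (S k)) (ν : K → ℝ) (k₀ : K) (ε : ℝ) : Prop :=
  V2_netAcrossFamily Λ P ν → StatementUpTo (P k₀) ε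

/-- CALIBRATION: for the one-member family (`Λ = {k₀}`, `ν k₀ > 0`) the transfer door at `ε = 0` HOLDS — it is print's reading «debt ≤ credit ⟹ Statement»
(`statement_iff_offRemainder_empty_le_credit`, `statementUpTo_zero_iff`). [claim: Mochizuki2012, status: disputed] -/
theorem V2_requirement_singleton {P : (k : K) → Cor312.Setting (S k)} {ν : K → ℝ} {k₀ : K} (H : BridgeHyps (P k₀)) (hν : 0 < ν k₀) :
    V2_requirement {k₀} P ν k₀ 0 := by
  intro h
  unfold V2_netAcrossFamily at h
  rw [Finset.sum_singleton] at h
  rw [statementUpTo_zero_iff, statement_iff_offRemainder_empty_le_credit H]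
  have hc : 0 ≤ credit (P k₀) - offRemainder (P k₀) ∅ := by
    by_contra hc
    push Not at hc
    nlinarith
  unfold credit at hc
  linarith

end V2Family

section V2Height

open Summit.ABC.IUTFork.Repair.RH.HeightScaling

/-- **B5 `PoolMediant` — the honest meta-object behind every widening** (sheet (b) B5 «`PoolMediant : Prop := ∀ finite families (f_i, M_i) with ExponentAtMost
(f_i) (−1) C_i and weights ν_i ≥ 0, ExponentAtMost (Σ ν_i M_i f_i / Σ ν_i M_i) (−1) (max_i C_i)` — pooling profiles of h-exponent −1 gives h-exponent −1 with
constant inside the members' range … STATUS: elementary (two lines from `Repair.RHHeightScaling.ExponentAtMost.add` :126 + `ExponentAtMost.mono`); its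
kernel face is rh2-q2-eq's PLANNED `RHHeightScalingMultiL.lean` (`priceBounded_pool`, `pool_le_sup_div`, `negExponent_pool` — MULTIL §4); this seat files
nothing (no duplicate face). CONSEQUENCE … B1 and B2 — and any scope widening whatsoever over a FIXED finite pool — cannot change the exponent −1 of AXIS-D2
rows 3/5»), in the p532994 vocabulary `ExponentAtMost f α C` («`f s ≤ C·s^α` for `s ≥ 1`»): the `ν·M`-weighted mean of finitely many profiles of exponent
`−1` has exponent `−1` with constant any common bound `Cmax ≥ C_i` of the member constants (the sheet's `max_i C_i`). Typed as the LAW a widening must BEAT (a `Prop`; its proof is rh2-q2-eq's planned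
face, deliberately not duplicated here). [folklore] -/
@[folklore]
def V2_B5_poolMediant : Prop :=
  ∀ (n : ℕ) (f : Fin n → ℝ → ℝ) (M ν C : Fin n → ℝ) (Cmax : ℝ), (∀ i, 0 ≤ ν i) → (∀ i, 0 < M i) → (0 < ∑ i, ν i * M i) →
    (∀ i, ExponentAtMost (f i) (-1) (C i)) → (∀ i, C i ≤ Cmax) →
      ExponentAtMost (fun s => (∑ i, ν i * M i * f i s) / ∑ i, ν i * M i) (-1) Cmax

end V2Height

end Summit.ABC.IUTFork.Repair.RH.Round4ConstraintRequirements

end
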